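import Mathlib
import HarnessLib
import Literature.MathematicalPhysics.KineticTheory.HardSphereEulerProofs
import Summits.AtomisticToContinuum.HydrodynamicLimit.Theorems.OneFlightGossipEngineKineticCurrentsWindowLDApriori
import Summits.AtomisticToContinuum.HydrodynamicLimit.Theorems.KineticFluxLdDecay.Negative.TiltBasics

/-!
# Static freezing of local Gibbs profiles — statics for measurable (frozen) profiles
# (helpers for the registered stub `stub_staticFreezing` of line
# `sigma-uniform-equilibrium-transfer`, crux `KineticCurrentsWindowLDUniform`,
# stmt-AtomisticToContinuum-14662)

The stub compares the local Gibbs law of `N + 1` hard spheres with continuous profiles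
`(a, u₀, θ₀)` to the law with FROZEN profiles `(a ∘ π, u₀ ∘ π, θ₀ ∘ π)`, `π` a measurable
self-map of `𝕋³` moving points by at most `ρ₀` (a step function in the chessboard transfer).
The frozen profiles are only measurable and bounded, while the disintegration API of
`HardSphereEulerProofs` (`lintegral_gibbsWeight_mul`, `canonicalPartition_eq_posPartition`)
assumes continuity (for measurability only). This file supplies what the stub needs:

* `lintegral_indicator_tensorPow` — Tonelli for the hard-sphere-restricted tensor power of a
  local Gibbs profile with measurable profiles: the Maxwellian velocity factors integrate to one,
  `∫ 𝟙_D ∏ᵢ a₀(xᵢ) M_{1,u₀(xᵢ),θ₀(xᵢ)}(vᵢ) dz = ∫ 𝟙_{no overlap}(x) ∏ᵢ a₀(xᵢ) dx`;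
* `ofReal_canonicalPartition_eq`, `canonicalPartition_le_pow_mul` (registered form:
  `stub_staticFreezing_partition`) — the canonical partition
  function of a bounded measurable profile is this (finite) integral, hence partition functions
  of pointwise comparable activities `a₁ ≤ c a₂` compare as `Z₁ ≤ cⁿ Z₂`, whatever the drifts
  and temperatures;
* `log_ratio_le` — the per-particle log-ratio `log (a M_{θ,u}) − log (a' M_{θ',u'})` at a
  velocity `w` is at most `e (5/2 + θₘ⁻¹) + e (1 + θₘ⁻¹)/2 · ‖w − u‖²` when the data differ by
  at most `e ≤ 1` (in `log a`, `log θ`, `u`, `θ⁻¹`) and `θ' ≥ θₘ`;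
* `lintegral_exp_mul_localMaxwellian_le` — the Gaussian fibre moment
  `∫ e^{s‖v−u‖²} M_{1,u,θ}(v) dv = (1 − 2sθ)^{-3/2} ≤ (1 − 2sΘ)^{-3/2}`;
* `exists_tolerance`, `exists_dist_le_forall_dist_lt` — the choice of the tolerance `e` from the
  Rényi order `p` and the budget `δ`, and of the displacement `ρ₀` from `e` (uniform continuity
  on the compact torus).

References: H. Spohn, *Large Scale Dynamics of Interacting Particles* (1991), Part I §2.3
(local equilibrium states); the disintegration pattern is `HardSphereEulerProofs.lean`.
-/

noncomputable section

open MeasureTheory Set Filter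
open scoped ENNReal Topology

namespace Summit.AtomisticToContinuum.HydrodynamicLimit.Theorems.KineticCurrentsWindowLDUniformSigmaUniform

open Literature.Analysis.FluidPDE (HardSphereFlow Config localMaxwellian canonicalDensity liouville)
open Literature.MathematicalPhysics.KineticTheory (T3 V3 hsDiameter localGibbsLaw localGibbsMeasure
  localGibbsProfile)
open Literature.Analysis.FluidPDE Literature.MathematicalPhysics.KineticTheory

namespace StaticFreezing

/-! ### Measurable (frozen) profiles: Tonelli and the partition function -/

/-- The local Gibbs profile `a₀(x) M_{1,u₀(x),θ₀(x)}(v)` of MEASURABLE profiles is measurable.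
[folklore] -/
theorem measurable_localGibbsProfile_of_measurable {a₀ θ₀ : T3 → ℝ} {u₀ : T3 → V3}
    (ha : Measurable a₀) (hθ : Measurable θ₀) (hu : Measurable u₀) :
    Measurable (localGibbsProfile a₀ u₀ θ₀) := by
  unfold localGibbsProfile localMaxwellian
  fun_prop

/-- The unit-density local Maxwellian has unit mass (`lintegral` form, `θ > 0`). [folklore] -/
theorem lintegral_ofReal_localMaxwellian {θ : ℝ} (hθ : 0 < θ) (u : V3) :
    ∫⁻ w, ENNReal.ofReal (localMaxwellian 1 θ u w) = 1 := by
  rw [← ofReal_integral_eq_lintegral_ofReal (integrable_localMaxwellian hθ u)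
      (Eventually.of_forall fun w => localMaxwellian_nonneg zero_le_one hθ.le u w),
    integral_localMaxwellian_one hθ u, ENNReal.ofReal_one]

/-- **Tonelli for the hard-sphere-restricted tensor power of a local Gibbs profile with
measurable profiles** (`a₀ ≥ 0`, `θ₀ > 0`): the Maxwellian velocity factors integrate to one,
`∫ 𝟙_D(z) ∏ᵢ a₀(xᵢ) M_{1,u₀(xᵢ),θ₀(xᵢ)}(vᵢ) dz = ∫ 𝟙_{no overlap}(x) ∏ᵢ a₀(xᵢ) dx`
(as lower Lebesgue integrals; adapted from `lintegral_gibbsWeight_mul`). [folklore] -/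
theorem lintegral_indicator_tensorPow {a₀ θ₀ : T3 → ℝ} {u₀ : T3 → V3}
    (ha : Measurable a₀) (hθ : Measurable θ₀) (hu : Measurable u₀)
    (ha0 : ∀ x, 0 ≤ a₀ x) (hθ0 : ∀ x, 0 < θ₀ x) (ε : ℝ) (n : ℕ) :
    ∫⁻ z, ENNReal.ofReal ((hardSphereDomain (Torus.geometry (Fin 3)) n ε).indicator
        (tensorPow n (localGibbsProfile a₀ u₀ θ₀)) z) =
      ∫⁻ x, ENNReal.ofReal (posWeight a₀ ε n x) := by
  set F : Config n (Fin 3) T3 → ℝ := (hardSphereDomain (Torus.geometry (Fin 3)) n ε).indicator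
    (tensorPow n (localGibbsProfile a₀ u₀ θ₀)) with hF
  have hFm : Measurable fun z => ENNReal.ofReal (F z) :=
    ((measurable_tensorPow (measurable_localGibbsProfile_of_measurable ha hθ hu) n).indicator
      (measurableSet_hardSphereDomain _ Torus.measurable_geometry_sepVec n ε)).ennreal_ofReal
  set M : (Fin n → T3) → Fin n → V3 → ℝ≥0∞ :=
    fun x i w => ENNReal.ofReal (localMaxwellian 1 (θ₀ (x i)) (u₀ (x i)) w) with hM
  have hMm : ∀ x i, Measurable (M x i) := fun x i =>
    (continuous_localMaxwellian 1 (θ₀ (x i)) (u₀ (x i))).measurable.ennreal_ofReal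
  have hpt : ∀ (x : Fin n → T3) (v : Fin n → V3), ENNReal.ofReal (F (zipConfig (x, v))) =
      ENNReal.ofReal (posWeight a₀ ε n x) * ∏ i, M x i (v i) := by
    intro x v
    rw [hF, indicator_tensorPow_zipConfig, ENNReal.ofReal_mul (posWeight_nonneg ha0 ε x),
      ENNReal.ofReal_prod_of_nonneg fun i _ =>
        localMaxwellian_nonneg zero_le_one (hθ0 (x i)).le _ _]
  calc ∫⁻ z, ENNReal.ofReal (F z)
      = ∫⁻ p, ENNReal.ofReal (F (zipConfig p))
          ∂((volume : Measure (Fin n → T3)).prod volume) := by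
        rw [← measurePreserving_zipConfig.lintegral_comp_emb
          (MeasurableEquiv.arrowProdEquivProdArrow T3 V3 (Fin n)).symm.measurableEmbedding]
    _ = ∫⁻ x, ∫⁻ v, ENNReal.ofReal (F (zipConfig (x, v))) :=
        lintegral_prod _ (hFm.comp measurable_zipConfig).aemeasurable
    _ = ∫⁻ x, ENNReal.ofReal (posWeight a₀ ε n x) * ∏ i, ∫⁻ w, M x i w := by
        refine lintegral_congr fun x => ?_
        have hf' : Measurable fun v : Fin n → V3 => ∏ i, M x i (v i) :=
          Finset.measurable_prod _ fun i _ => (hMm x i).comp (measurable_pi_apply i)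
        simp_rw [hpt x]
        rw [lintegral_const_mul _ hf', volume_pi,
          lintegral_fintype_prod_eq_prod' (fun _ => (volume : Measure V3)) (hMm x)]
    _ = ∫⁻ x, ENNReal.ofReal (posWeight a₀ ε n x) := by
        refine lintegral_congr fun x => ?_
        rw [Finset.prod_eq_one fun i _ => ?_, mul_one]
        exact lintegral_ofReal_localMaxwellian (hθ0 (x i)) _

/-- Position weights of pointwise comparable activities `0 ≤ a₁ ≤ c a₂` compare as
`w₁ ≤ cⁿ w₂`. [folklore] -/
theorem posWeight_le_pow_mul_posWeight {a₁ a₂ : T3 → ℝ} (h1 : ∀ y, 0 ≤ a₁ y) {c : ℝ}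
    (h : ∀ y, a₁ y ≤ c * a₂ y) (ε : ℝ) (n : ℕ) (x : Fin n → T3) :
    posWeight a₁ ε n x ≤ c ^ n * posWeight a₂ ε n x := by
  unfold posWeight
  by_cases hx : x ∈ posDomain ε n
  · rw [indicator_of_mem hx, indicator_of_mem hx]
    calc ∏ i, a₁ (x i) ≤ ∏ i, c * a₂ (x i) :=
          Finset.prod_le_prod (fun i _ => h1 _) fun i _ => h _
      _ = c ^ n * ∏ i, a₂ (x i) := by
          rw [Finset.prod_mul_distrib, Finset.prod_const, Finset.card_univ, Fintype.card_fin]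
  · simp only [indicator_of_notMem hx, mul_zero, le_refl]

/-- **The canonical partition function of a bounded measurable profile is the position
integral.** For measurable `0 ≤ a₀ ≤ A`, `θ₀ > 0`, `u₀`:
`𝒵ₙ = ∫ 𝟙_{no overlap}(x) ∏ᵢ a₀(xᵢ) dx` (in `ℝ≥0∞`; in particular the Bochner integral
defining `canonicalPartition` is a genuine, finite integral, not the junk value). [folklore] -/
theorem ofReal_canonicalPartition_eq {a₀ θ₀ : T3 → ℝ} {u₀ : T3 → V3}
    (ha : Measurable a₀) (hθ : Measurable θ₀) (hu : Measurable u₀)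
    (ha0 : ∀ x, 0 ≤ a₀ x) {A : ℝ} (hA : ∀ x, a₀ x ≤ A) (hθ0 : ∀ x, 0 < θ₀ x) (ε : ℝ) (n : ℕ) :
    ENNReal.ofReal (canonicalPartition (Torus.geometry (Fin 3)) ε n (localGibbsProfile a₀ u₀ θ₀)) =
      ∫⁻ x, ENNReal.ofReal (posWeight a₀ ε n x) := by
  set F : Config n (Fin 3) T3 → ℝ := (hardSphereDomain (Torus.geometry (Fin 3)) n ε).indicator
    (tensorPow n (localGibbsProfile a₀ u₀ θ₀)) with hF
  have hFm : Measurable F :=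
    (measurable_tensorPow (measurable_localGibbsProfile_of_measurable ha hθ hu) n).indicator
      (measurableSet_hardSphereDomain _ Torus.measurable_geometry_sepVec n ε)
  have hF0 : ∀ z, 0 ≤ F z := fun z => Set.indicator_nonneg
    (fun w _ => tensorPow_nonneg (localGibbsProfile_nonneg ha0 fun x => (hθ0 x).le) n w) z
  have hlin := lintegral_indicator_tensorPow ha hθ hu ha0 hθ0 ε n
  have hfin : ∫⁻ x, ENNReal.ofReal (posWeight a₀ ε n x) < ∞ := by
    refine lt_of_le_of_lt (lintegral_mono fun x =>
      ENNReal.ofReal_le_ofReal (posWeight_le_pow ha0 hA ε x)) ?_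
    rw [lintegral_const]
    exact ENNReal.mul_lt_top ENNReal.ofReal_lt_top (measure_lt_top _ _)
  have hint : Integrable F := ⟨hFm.aestronglyMeasurable,
    (hasFiniteIntegral_iff_ofReal (Eventually.of_forall hF0)).2 (hlin ▸ hfin)⟩
  rw [canonicalPartition, ofReal_integral_eq_lintegral_ofReal hint (Eventually.of_forall hF0)]
  exact hlin

/-- **Partition functions of comparable activities.** For measurable profiles with
`θ₁, θ₂ > 0`, `0 ≤ a₁ ≤ c a₂` pointwise and `0 ≤ a₂ ≤ A`:
`𝒵ₙ(a₁, u₁, θ₁) ≤ cⁿ 𝒵ₙ(a₂, u₂, θ₂)` — the Maxwellian velocity factors integrate to one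
whatever the (measurable) drift and temperature profiles. [folklore] -/
theorem canonicalPartition_le_pow_mul {a₁ a₂ θ₁ θ₂ : T3 → ℝ} {u₁ u₂ : T3 → V3}
    (ha₁ : Measurable a₁) (hθ₁ : Measurable θ₁) (hu₁ : Measurable u₁)
    (ha₂ : Measurable a₂) (hθ₂ : Measurable θ₂) (hu₂ : Measurable u₂)
    (h10 : ∀ x, 0 ≤ a₁ x) (h20 : ∀ x, 0 ≤ a₂ x) {A : ℝ} (hA : ∀ x, a₂ x ≤ A)
    (hθ10 : ∀ x, 0 < θ₁ x) (hθ20 : ∀ x, 0 < θ₂ x) {c : ℝ} (hc : 0 ≤ c)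
    (h : ∀ y, a₁ y ≤ c * a₂ y) (ε : ℝ) (n : ℕ) :
    canonicalPartition (Torus.geometry (Fin 3)) ε n (localGibbsProfile a₁ u₁ θ₁) ≤
      c ^ n * canonicalPartition (Torus.geometry (Fin 3)) ε n (localGibbsProfile a₂ u₂ θ₂) := by
  have hA1 : ∀ x, a₁ x ≤ c * A := fun x => (h x).trans (mul_le_mul_of_nonneg_left (hA x) hc)
  rw [← ENNReal.ofReal_le_ofReal_iff (mul_nonneg (pow_nonneg hc n)
      (canonicalPartition_nonneg _ _ _ (localGibbsProfile_nonneg h20 fun x => (hθ20 x).le))),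
    ENNReal.ofReal_mul (pow_nonneg hc n), ofReal_canonicalPartition_eq ha₁ hθ₁ hu₁ h10 hA1 hθ10,
    ofReal_canonicalPartition_eq ha₂ hθ₂ hu₂ h20 hA hθ20,
    ← lintegral_const_mul' _ _ ENNReal.ofReal_ne_top]
  refine lintegral_mono fun x => ?_
  rw [← ENNReal.ofReal_mul (pow_nonneg hc n)]
  exact ENNReal.ofReal_le_ofReal (posWeight_le_pow_mul_posWeight h10 h ε n x)

/-! ### The per-particle log-ratio -/

/-- **Per-particle log-ratio of a local Gibbs profile and its frozen version.** If
`a, a', θ, θ' > 0`, `θ' ≥ θₘ > 0`, and the data differ by at most `e ∈ [0, 1]`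
(`log a − log a' ≤ e`, `log θ' − log θ ≤ e`, `‖u − u'‖ ≤ e`, `θ'⁻¹ − θ⁻¹ ≤ e`), then for every
velocity `w`,
`log (a M_{1,u,θ}(w)) − log (a' M_{1,u',θ'}(w)) ≤ e (5/2 + θₘ⁻¹) + e (1 + θₘ⁻¹)/2 · ‖w − u‖²`
(`‖w − u'‖² ≤ (‖w − u‖ + ‖u − u'‖)²` and `2r d ≤ d (r² + 1)`; the closed form of `log M` is
`KineticFluxLdDecayTilt.log_localMaxwellian`). [folklore] -/
theorem log_ratio_le {a a' θ θ' e θm : ℝ} {u u' : V3} (ha : 0 < a) (ha' : 0 < a')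
    (hθ : 0 < θ) (hθ' : 0 < θ') (hθm : 0 < θm) (hθm' : θm ≤ θ') (he0 : 0 ≤ e) (he1 : e ≤ 1)
    (hla : Real.log a - Real.log a' ≤ e) (hlθ : Real.log θ' - Real.log θ ≤ e)
    (hu : ‖u - u'‖ ≤ e) (hι : θ'⁻¹ - θ⁻¹ ≤ e) (w : V3) :
    Real.log (a * localMaxwellian 1 θ u w) - Real.log (a' * localMaxwellian 1 θ' u' w) ≤
      e * (5 / 2 + θm⁻¹) + e * (1 + θm⁻¹) / 2 * ‖w - u‖ ^ 2 := by
  rw [Real.log_mul ha.ne' (localMaxwellian_pos one_pos hθ u w).ne',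
    Real.log_mul ha'.ne' (localMaxwellian_pos one_pos hθ' u' w).ne',
    KineticFluxLdDecayTilt.log_localMaxwellian hθ, KineticFluxLdDecayTilt.log_localMaxwellian hθ',
    Real.log_mul (by positivity) hθ.ne', Real.log_mul (by positivity) hθ'.ne',
    show ‖w - u‖ ^ 2 / (2 * θ) = θ⁻¹ * ‖w - u‖ ^ 2 / 2 by
      rw [div_eq_mul_inv, mul_inv, mul_comm]; ring,
    show ‖w - u'‖ ^ 2 / (2 * θ') = θ'⁻¹ * ‖w - u'‖ ^ 2 / 2 by
      rw [div_eq_mul_inv, mul_inv, mul_comm]; ring]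
  set r := ‖w - u‖ with hr
  set d := ‖u - u'‖ with hd
  have hr0 : 0 ≤ r := norm_nonneg _
  have hd0 : 0 ≤ d := norm_nonneg _
  have hι0 : 0 ≤ θ'⁻¹ := inv_nonneg.2 hθ'.le
  have hιm : θ'⁻¹ ≤ θm⁻¹ := (inv_le_inv₀ hθ' hθm).2 hθm'
  have hde : d ≤ e := hu
  have h1 : ‖w - u'‖ ≤ r + d := by
    simpa only [hr, hd, sub_add_sub_cancel] using norm_add_le (w - u) (u - u')
  have h2 : ‖w - u'‖ ^ 2 ≤ r ^ 2 * (1 + d) + d + d ^ 2 := by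
    calc ‖w - u'‖ ^ 2 ≤ (r + d) ^ 2 := pow_le_pow_left₀ (norm_nonneg _) h1 2
      _ ≤ r ^ 2 * (1 + d) + d + d ^ 2 := by nlinarith [mul_nonneg hd0 (sq_nonneg (r - 1))]
  have h3 : θ'⁻¹ * ‖w - u'‖ ^ 2 ≤ θ'⁻¹ * (r ^ 2 * (1 + d) + d + d ^ 2) :=
    mul_le_mul_of_nonneg_left h2 hι0
  have h4 : θ'⁻¹ * d ≤ θm⁻¹ * e := mul_le_mul hιm hde hd0 (inv_nonneg.2 hθm.le)
  have h5 : d ^ 2 ≤ e := by nlinarith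
  have h6 : θ'⁻¹ * (d + d ^ 2) ≤ θm⁻¹ * (2 * e) :=
    mul_le_mul hιm (by linarith) (by positivity) (inv_nonneg.2 hθm.le)
  have h7 : r ^ 2 * (θ'⁻¹ - θ⁻¹ + θ'⁻¹ * d) ≤ r ^ 2 * (e + θm⁻¹ * e) :=
    mul_le_mul_of_nonneg_left (by linarith) (sq_nonneg r)
  nlinarith [h3, h4, h6, h7]

/-! ### The Gaussian fibre moment -/

/-- **Fibre exponential moment of the squared fluctuation.** For `0 < θ ≤ Θ`, `0 ≤ s` and
`2sΘ < 1`: `∫ exp(s‖v−u‖²) M_{1,u,θ}(v) dv = (1 − 2sθ)^{-3/2} ≤ (1 − 2sΘ)^{-3/2}`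
(`lintegral_exp_mul_norm_sub_sq_gaussMeasure`). [folklore] -/
theorem lintegral_exp_mul_localMaxwellian_le {θ Θ s : ℝ} (hθ : 0 < θ) (hθΘ : θ ≤ Θ)
    (hs : 0 ≤ s) (hΘ : 2 * s * Θ < 1) (u : V3) :
    ∫⁻ v, ENNReal.ofReal (Real.exp (s * ‖v - u‖ ^ 2)) *
        ENNReal.ofReal (localMaxwellian 1 θ u v) ≤
      ENNReal.ofReal ((1 - 2 * s * Θ) ^ (-(3 : ℝ) / 2)) := by
  have hsθ : 2 * s * θ < 1 := lt_of_le_of_lt (by nlinarith) hΘ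
  have hM : Measurable fun v : V3 => ENNReal.ofReal (localMaxwellian 1 θ u v) :=
    (continuous_localMaxwellian 1 θ u).measurable.ennreal_ofReal
  have hg : Measurable fun v : V3 => ENNReal.ofReal (Real.exp (s * ‖v - u‖ ^ 2)) := by
    fun_prop
  calc ∫⁻ v, ENNReal.ofReal (Real.exp (s * ‖v - u‖ ^ 2)) *
        ENNReal.ofReal (localMaxwellian 1 θ u v)
      = ∫⁻ v, ENNReal.ofReal (Real.exp (s * ‖v - u‖ ^ 2)) ∂gaussMeasure u θ := by
        rw [← withDensity_localMaxwellian_eq_gaussMeasure hθ u,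
          lintegral_withDensity_eq_lintegral_mul _ hM hg]
        exact lintegral_congr fun v => mul_comm _ _
    _ = ENNReal.ofReal ((1 - 2 * s * θ) ^ (-(3 : ℝ) / 2)) := by
        rw [lintegral_exp_mul_norm_sub_sq_gaussMeasure hθ hsθ u, finrank_euclideanSpace_fin]
        norm_num
    _ ≤ ENNReal.ofReal ((1 - 2 * s * Θ) ^ (-(3 : ℝ) / 2)) :=
        ENNReal.ofReal_le_ofReal
          (Real.rpow_le_rpow_of_nonpos (by linarith) (by nlinarith) (by norm_num))

/-! ### Choice of the constants -/

/-- **Choice of the tolerance.** For `p > 1`, `δ > 0`, `A ≥ 0`, `B > 0` there is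
`0 < e ≤ 1` with `(p − 1) B e ≤ 1/2` and `exp((p−1) A e) (1 − (p−1) B e)^{-3/2} ≤ exp(p δ)`
(`(1 − t)⁻¹ ≤ e^{2t}` on `[0, 1/2]`). [folklore] -/
theorem exists_tolerance {p δ A B : ℝ} (hp : 1 < p) (hδ : 0 < δ) (hA : 0 ≤ A) (hB : 0 < B) :
    ∃ e : ℝ, 0 < e ∧ e ≤ 1 ∧ (p - 1) * B * e ≤ 1 / 2 ∧
      Real.exp ((p - 1) * A * e) * (1 - (p - 1) * B * e) ^ (-(3 : ℝ) / 2) ≤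
        Real.exp (p * δ) := by
  have hp1 : 0 < p - 1 := sub_pos.2 hp
  have hp0 : 0 < p := by linarith
  obtain ⟨e, he0, he1, he2, he3⟩ : ∃ e : ℝ, 0 < e ∧ e ≤ 1 ∧ e * (2 * (p - 1) * B) ≤ 1 ∧
      e * ((p - 1) * (A + 3 * B)) ≤ p * δ :=
    ⟨min 1 (min (1 / (2 * (p - 1) * B)) (p * δ / ((p - 1) * (A + 3 * B)))),
      lt_min one_pos (lt_min (by positivity) (by positivity)), min_le_left _ _,
      (le_div_iff₀ (by positivity)).1 ((min_le_right _ _).trans (min_le_left _ _)),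
      (le_div_iff₀ (by positivity)).1 ((min_le_right _ _).trans (min_le_right _ _))⟩
  have ht0 : 0 ≤ (p - 1) * B * e := by positivity
  have ht2 : (p - 1) * B * e ≤ 1 / 2 := by nlinarith
  have hk : 0 < 1 - (p - 1) * B * e := by linarith
  have h1 : (1 - (p - 1) * B * e)⁻¹ ≤ Real.exp (2 * ((p - 1) * B * e)) := by
    rw [inv_le_iff_one_le_mul₀' hk]
    nlinarith [mul_nonneg hk.le (sub_nonneg.2 (Real.add_one_le_exp (2 * ((p - 1) * B * e)))),
      mul_nonneg ht0 (sub_nonneg.2 ht2)]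
  refine ⟨e, he0, he1, ht2, ?_⟩
  calc Real.exp ((p - 1) * A * e) * (1 - (p - 1) * B * e) ^ (-(3 : ℝ) / 2)
      ≤ Real.exp ((p - 1) * A * e) * Real.exp (2 * ((p - 1) * B * e)) ^ ((3 : ℝ) / 2) := by
        rw [show (-(3 : ℝ) / 2) = -((3 : ℝ) / 2) by ring, Real.rpow_neg hk.le,
          ← Real.inv_rpow hk.le]
        exact mul_le_mul_of_nonneg_left
          (Real.rpow_le_rpow (inv_nonneg.2 hk.le) h1 (by norm_num)) (Real.exp_nonneg _)
    _ = Real.exp (e * ((p - 1) * (A + 3 * B))) := by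
        rw [← Real.exp_mul, ← Real.exp_add]
        congr 1
        ring
    _ ≤ Real.exp (p * δ) := Real.exp_le_exp.2 he3

/-- **Uniform continuity on the compact torus, displacement form.** For a continuous `F` on
`𝕋³` and `e > 0` there is `ρ > 0` such that points at distance `≤ ρ` have `F`-values at
distance `< e`. [folklore] -/
theorem exists_dist_le_forall_dist_lt {M : Type*} [PseudoMetricSpace M] {F : T3 → M}
    (hF : Continuous F) {e : ℝ} (he : 0 < e) :
    ∃ ρ : ℝ, 0 < ρ ∧ ∀ x y : T3, dist x y ≤ ρ → dist (F x) (F y) < e := by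
  obtain ⟨ρ, hρ, h⟩ :=
    Metric.uniformContinuous_iff.1 (CompactSpace.uniformContinuous_of_continuous hF) e he
  exact ⟨ρ / 2, half_pos hρ, fun x y hxy => h (hxy.trans_lt (half_lt_self hρ))⟩

end StaticFreezing

/-- **Registered helper stub `stub_staticFreezing_partition`** (statics file of the stub
`stub_staticFreezing`, line `sigma-uniform-equilibrium-transfer`, crux
stmt-AtomisticToContinuum-14662): canonical partition functions of hard spheres with local Gibbs
profiles whose (merely measurable) activities compare pointwise, `0 ≤ a₁ ≤ c a₂`, `a₂` bounded,
`θ₁, θ₂ > 0`, compare as `𝒵ₙ(a₁,u₁,θ₁) ≤ cⁿ 𝒵ₙ(a₂,u₂,θ₂)` — whatever the drift and temperature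
profiles, since the Maxwellian velocity factors integrate to one
(`StaticFreezing.canonicalPartition_le_pow_mul`). [folklore] -/
theorem stub_staticFreezing_partition :
    ∀ (a₁ a₂ θ₁ θ₂ : T3 → ℝ) (u₁ u₂ : T3 → V3), Measurable a₁ → Measurable θ₁ → Measurable u₁ →
    Measurable a₂ → Measurable θ₂ → Measurable u₂ → (∀ x, 0 ≤ a₁ x) → (∀ x, 0 ≤ a₂ x) →
    ∀ A : ℝ, (∀ x, a₂ x ≤ A) → (∀ x, 0 < θ₁ x) → (∀ x, 0 < θ₂ x) → ∀ c : ℝ, 0 ≤ c →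
    (∀ y, a₁ y ≤ c * a₂ y) → ∀ (ε : ℝ) (n : ℕ),
      Literature.Analysis.FluidPDE.canonicalPartition (Literature.Analysis.FluidPDE.Torus.geometry (Fin 3))
          ε n (localGibbsProfile a₁ u₁ θ₁) ≤
        c ^ n * Literature.Analysis.FluidPDE.canonicalPartition
          (Literature.Analysis.FluidPDE.Torus.geometry (Fin 3)) ε n (localGibbsProfile a₂ u₂ θ₂) :=
  fun _a₁ _a₂ _θ₁ _θ₂ _u₁ _u₂ ha₁ hθ₁ hu₁ ha₂ hθ₂ hu₂ h10 h20 _A hA hθ10 hθ20 _c hc h ε n =>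
    StaticFreezing.canonicalPartition_le_pow_mul ha₁ hθ₁ hu₁ ha₂ hθ₂ hu₂ h10 h20 hA hθ10 hθ20 hc
      h ε n

end Summit.AtomisticToContinuum.HydrodynamicLimit.Theorems.KineticCurrentsWindowLDUniformSigmaUniform

end
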